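/-
Copyright (c) 2026. All rights reserved.
Released under Apache 2.0 license as described in the file LICENSE.
Authors: HodgeCM publication cell (pub-hodgecm), floor-0 programme P4 (engine E-2), prover `A-p12`.
-/
import Literature.NumberTheory.Weil1964.AdelicDoublingGeometricFrameBorel
import Literature.NumberTheory.Weil1964.AdelicSiegelParabolicLift
import Literature.NumberTheory.Weil1964.AdelicMetaplecticRationalLiftIsometric
import HarnessLib

/-!
# The geometric frame of the doubling diagonal, III: the Borel translates as ELEMENTS of `Mp_ψ(W□_𝔸)ᶜᵒⁿᵗ`

Topic `NumberTheory/Weil1964`; namespace `Literature.NumberTheory.Weil1964`.  KERNEL MATHEMATICS ONLY: theorems over existing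
tree declarations; no definition, no `def … : Prop`, no `axiom`, no proof hole.  Sequel of ★ `AdelicDoublingGeometricFrameBorel`
(the OPERATOR laws of Weil's `𝐫₀` on the `δ`-conjugate of a Borel translate of the doubled `W`-member: unipotent translate =
chirp, torus translate = pure twist after conjugation by the frame chirp `t(C₀)`, `C₀ = frameHalfRat`).

THE POINT ([Weil1964, Chap. I n° 13], [Weil1965, n° 46–50]).  The boundedness step of the Siegel–Weil formula (sheet
`SW2c-BOUND-ASSEMBLY`, ★ `Weil1965/SiegelWeilBorelBound.exists_borelBound`) quantifies over GENUINE elements `q` of the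
metaplectic group of record `Mp_ψ(W□_𝔸)ᶜᵒⁿᵗ = adelicMpCont` whose Weil operator is on the nose a chirp followed by a twist,
`ω(q) Ψ = chirpLM S (twistLM a Ψ)`.  This file manufactures them from ★ `AdelicDoublingGeometricFrameBorel`: the frame chirp `t(C₀)`
IS the operator of a unipotent pair `u₀ = (v(c₀), t(C₀)) ∈ Mp_ψ(W□_𝔸)ᶜᵒⁿᵗ` (`c₀ = −(C₀ + C₀ᵀ)`, Weil's `t₀`; so `v(c₀)·δ` is the frame
element `δ♮` of the sheet AS A GROUP ELEMENT), and conjugating Weil's lift `𝐫₀ᶜᵒⁿᵗ(P)` of the parabolic element `P = δ g δ⁻¹` by `u₀`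
turns the operator laws into identities of Weil operators of ELEMENTS:
* `exists_frameUnipPair` — `∃ u₀ ∈ Mp_ψ(W□_𝔸)ᶜᵒⁿᵗ`, `ω(u₀) = t(C₀)` on functions, `π(u₀) = v(c₀)`, `L(u₀) = 1`;
* (J-N) `omega_adelicSiegelLiftCont_of_unipShape` ∕ `omega_conj_adelicSiegelLiftCont_of_unipShape` — for the unipotent translate
  `ω(𝐫₀ᶜᵒⁿᵗ P) = chirpLM S_b = ω(u₀ · 𝐫₀ᶜᵒⁿᵗ P · u₀⁻¹)` (chirps commute);
* (J-D) `omega_conj_adelicSiegelLiftCont_of_torusShape` — for the torus translate `ω(u₀ · 𝐫₀ᶜᵒⁿᵗ P · u₀⁻¹) = twistLM M` (ANY invertible `M`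
  with the prescribed entries), and `…_of_realRay` — `= twistLM (p₂ • 1)` on the real ray;
* (J-ND) `omega_conj_adelicSiegelLiftCont_mul` — for a product `P_N · P_D`: `ω(u₀ · 𝐫₀ᶜᵒⁿᵗ(P_N P_D) · u₀⁻¹) Ψ = chirpLM S_b (twistLM M Ψ)`,
  exactly the hypothesis shape `hGω` of ★ `exists_borelBound`; and `proj_conj_adelicSiegelLiftCont` for its symplectic shadow.
Cell `hodgecm-mathlib`, floor-0 line P4, engine E-2, crux H413; junction between the (L-N)(L-D) producer and the SW2c-BOUND assembly.

References: [Weil1964] A. Weil, Acta Math. 111 (1964), Chap. I n° 13 p. 160 (`𝐫₀`, `d₀`, `t₀`); [Weil1965] A. Weil, Acta Math. 113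
(1965), n° 46 p. 66 and n° 47–50 (the Borel translates in the boundedness step).
-/

set_option autoImplicit false

noncomputable section

namespace Literature.NumberTheory.Weil1964

open Literature.RepresentationTheory.HeisenbergGroup
open Literature.RepresentationTheory.HeisenbergGroup.SymplecticMatrix
open Literature.NumberTheory.Automorphic
open Literature.NumberTheory.Automorphic.UnitaryGroup (spReindex)
open NumberField
open scoped Matrix

variable (F : Type) [Field F] [NumberField F] {n : ℕ}
variable (T : Matrix (Fin n) (Fin n) (AdeleRing (𝓞 F) F)) (hT : IsUnit T.det)

/-! ## §1 The frame chirp `t(C₀)` is the operator of a unipotent pair `u₀ ∈ Mp_ψ(W□_𝔸)ᶜᵒⁿᵗ` -/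

/-- `q_{½(S + Sᵀ)} = q_S`: a quadratic form only sees the symmetric part of its matrix. [folklore] -/
private theorem sdForm_half_add_transpose {m : ℕ} (S : Matrix (Fin m) (Fin m) (AdeleRing (𝓞 F) F)) (x : Fin m → AdeleRing (𝓞 F) F) :
    sdForm F ((-⅟(2 : AdeleRing (𝓞 F) F)) • (-(S + Sᵀ))) x = sdForm F S x := by
  rw [smul_neg, neg_smul, neg_neg, sdForm_apply, sdForm_apply, Matrix.vecMul_smul, smul_dotProduct, Matrix.vecMul_add,
    add_dotProduct, Matrix.vecMul_transpose, dotProduct_comm (S *ᵥ x) x, ← Matrix.dotProduct_mulVec, smul_eq_mul, ← two_mul,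
    ← mul_assoc, invOf_mul_self, one_mul]

/-- `−(S + Sᵀ)` is symmetric. [folklore] -/
private theorem isSymm_neg_add_transpose {m : ℕ} (S : Matrix (Fin m) (Fin m) (AdeleRing (𝓞 F) F)) : (-(S + Sᵀ)).IsSymm :=
  ((Matrix.isSymm_add_transpose_self S)).neg

variable [MeasurableSpace (AdeleRing (𝓞 F) F)] [BorelSpace (AdeleRing (𝓞 F) F)]
  (ν : MeasureTheory.Measure (Fin (n + n) → AdeleRing (𝓞 F) F)) [ν.IsAddHaarMeasure]

include hT in
/-- **THE FRAME UNIPOTENT PAIR**: there is `u₀ ∈ Mp_ψ(W□_𝔸)ᶜᵒⁿᵗ` — namely Weil's `(v(c₀), t₀)` with `c₀ = −(C₀ + C₀ᵀ)` — whose Weil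
operator IS the frame chirp `t(C₀)` of ★ `AdelicDoublingGeometricFrame` on the nose, lying over the unipotent `v(c₀) ∈ N_𝕐(𝔸)` and
`L²`-isometric (`δ♮ := v(c₀)·δ` is the sheet's frame element as a GROUP element). [cite: Weil1964, Chap. I n° 13 p. 160] -/
theorem exists_frameUnipPair :
    ∃ u₀ : adelicMpCont F (Fin (n + n)) (doubledGramFin F T),
      (∀ Φ : piSchwartzBruhat F (Fin (n + n)),
        ((adelicMpCont.omega F (Fin (n + n)) (doubledGramFin F T) u₀ Φ : piSchwartzBruhat F (Fin (n + n))) :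
            (Fin (n + n) → AdeleRing (𝓞 F) F) → ℂ) =
          chirp F (ratMatrix F (frameHalfRat F)) (Φ : (Fin (n + n) → AdeleRing (𝓞 F) F) → ℂ)) ∧
      adelicMpCont.proj F (Fin (n + n)) (doubledGramFin F T) u₀ =
        unipotentSp (adelicForm F (Fin (n + n)) (doubledGramFin F T))
          (lowLin (doubledGramFin F T) (-(ratMatrix F (frameHalfRat F) + (ratMatrix F (frameHalfRat F))ᵀ)))
          (lowLin_symm (doubledGramFin F T) (isUnit_det_doubledGramFin F T hT) _ (isSymm_neg_add_transpose F _)) ∧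
      adelicMpCont.l2Scaling F (doubledGramFin F T) (isUnit_det_doubledGramFin F T hT) ν u₀ = 1 := by
  refine ⟨⟨unipPair F (doubledGramFin F T) (isUnit_det_doubledGramFin F T hT) _ (isSymm_neg_add_transpose F _),
      unipPair_mem_adelicMpCont F (doubledGramFin F T) (isUnit_det_doubledGramFin F T hT) _ _⟩,
    fun Φ => ?_, rfl, adelicMpCont.l2Scaling_unipPair F (doubledGramFin F T) (isUnit_det_doubledGramFin F T hT) ν _ _⟩
  refine (coe_toOp_unipPair F (doubledGramFin F T) (isUnit_det_doubledGramFin F T hT) _ (isSymm_neg_add_transpose F _) Φ).trans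
    (funext fun x => ?_)
  rw [chirp_apply, chirp_apply, sdChar, sdChar, sdForm_half_add_transpose]

/-! ## §2 Conjugating `𝐫₀ᶜᵒⁿᵗ(δ g δ⁻¹)` by the frame pair: Borel translates as elements with `ω = chirpLM ∘ twistLM` -/

section Junction

omit [MeasurableSpace (AdeleRing (𝓞 F) F)] [BorelSpace (AdeleRing (𝓞 F) F)]

variable (g gN gD : symplecticGroup (polar (Matrix.toLinearMap₂' (AdeleRing (𝓞 F) F) (Matrix.fromBlocks T 0 0 (-T)))))
  (P PN PD : siegelParabolicPi (doubledGramFin F T))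
  (u₀ : adelicMpCont F (Fin (n + n)) (doubledGramFin F T))
  (hu₀ : ∀ Φ : piSchwartzBruhat F (Fin (n + n)),
    ((adelicMpCont.omega F (Fin (n + n)) (doubledGramFin F T) u₀ Φ : piSchwartzBruhat F (Fin (n + n))) :
        (Fin (n + n) → AdeleRing (𝓞 F) F) → ℂ) =
      chirp F (ratMatrix F (frameHalfRat F)) (Φ : (Fin (n + n) → AdeleRing (𝓞 F) F) → ℂ))

/-- `ω(a · b · c) Ψ = ω(a) (ω(b) (ω(c) Ψ))`. [folklore] -/
private theorem omega_mul_mul_apply (a b c : adelicMpCont F (Fin (n + n)) (doubledGramFin F T))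
    (Ψ : piSchwartzBruhat F (Fin (n + n))) :
    adelicMpCont.omega F (Fin (n + n)) (doubledGramFin F T) (a * b * c) Ψ =
      adelicMpCont.omega F (Fin (n + n)) (doubledGramFin F T) a
        (adelicMpCont.omega F (Fin (n + n)) (doubledGramFin F T) b (adelicMpCont.omega F (Fin (n + n)) (doubledGramFin F T) c Ψ)) :=
  (adelicMpCont.omega_mul_apply F (doubledGramFin F T) (a * b) c Ψ).trans (adelicMpCont.omega_mul_apply F (doubledGramFin F T) a b _)

/-- **π of the conjugated lift**: `π(u₀ · 𝐫₀ᶜᵒⁿᵗ P · u₀⁻¹) = π(u₀) · P · π(u₀)⁻¹` (the `δ♮`-conjugate of the translate, `δ♮ = v(c₀) δ`).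
[cite: Weil1964, Chap. I n° 13 p. 160] -/
theorem proj_conj_adelicSiegelLiftCont :
    adelicMpCont.proj F (Fin (n + n)) (doubledGramFin F T)
        (u₀ * adelicSiegelLiftCont F (doubledGramFin F T) (isUnit_det_doubledGramFin F T hT) P * u₀⁻¹) =
      adelicMpCont.proj F (Fin (n + n)) (doubledGramFin F T) u₀ *
        (P : symplecticGroup (polar (adelicForm F (Fin (n + n)) (doubledGramFin F T)))) *
          (adelicMpCont.proj F (Fin (n + n)) (doubledGramFin F T) u₀)⁻¹ :=
  (map_mul (adelicMpCont.proj F (Fin (n + n)) (doubledGramFin F T)) _ _).trans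
    (congrArg₂ (· * ·) ((map_mul (adelicMpCont.proj F (Fin (n + n)) (doubledGramFin F T)) _ _).trans
      (congrArg (adelicMpCont.proj F (Fin (n + n)) (doubledGramFin F T) u₀ * ·)
        (proj_adelicSiegelLiftCont F (doubledGramFin F T) (isUnit_det_doubledGramFin F T hT) P)))
      (map_inv (adelicMpCont.proj F (Fin (n + n)) (doubledGramFin F T)) u₀))

section Unip

variable {b d : AdeleRing (𝓞 F) F}
  (hP : (P : symplecticGroup (polar (adelicForm F (Fin (n + n)) (doubledGramFin F T)))) =
    spReindex finSumFinEquiv (Matrix.fromBlocks T 0 0 (-T)) (doublingDelta T hT * g * (doublingDelta T hT)⁻¹))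
  (hN' : ∀ x₁ x₂ y₁ y₂ : Fin n → AdeleRing (𝓞 F) F,
    ((g : symplecticGroup (polar (Matrix.toLinearMap₂' (AdeleRing (𝓞 F) F) (Matrix.fromBlocks T 0 0 (-T))))) :
        ((Fin n ⊕ Fin n → AdeleRing (𝓞 F) F) × (Fin n ⊕ Fin n → AdeleRing (𝓞 F) F)) ≃ₗ[AdeleRing (𝓞 F) F]
          ((Fin n ⊕ Fin n → AdeleRing (𝓞 F) F) × (Fin n ⊕ Fin n → AdeleRing (𝓞 F) F))).symm (Sum.elim x₁ x₂, Sum.elim y₁ y₂) =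
      (Sum.elim (x₁ + (d * b) • (y₁ - y₂)) (x₂ + (d * b) • (y₁ - y₂)),
        Sum.elim (y₁ + b • (x₁ - x₂)) (y₂ + b • (x₁ - x₂))))

include hP hN' in
/-- **(J-N) THE UNIPOTENT TRANSLATE IN THE GROUP OF RECORD**: `ω(𝐫₀ᶜᵒⁿᵗ P) = chirpLM S_b` for `P = δ n δ⁻¹`,
`S_b = ((½ b T) ⊕ (−½ d b T⁻¹))` renumbered. [cite: Weil1964, Chap. I n° 13 p. 160] [cite: Weil1965, n° 46 p. 66] -/
theorem omega_adelicSiegelLiftCont_of_unipShape (Φ : piSchwartzBruhat F (Fin (n + n))) :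
    adelicMpCont.omega F (Fin (n + n)) (doubledGramFin F T)
        (adelicSiegelLiftCont F (doubledGramFin F T) (isUnit_det_doubledGramFin F T hT) P) Φ =
      chirpLM F (Matrix.reindex finSumFinEquiv finSumFinEquiv
          (Matrix.fromBlocks ((⅟(2 : AdeleRing (𝓞 F) F) * b) • T) 0 0
            (-(((⅟(2 : AdeleRing (𝓞 F) F) * (d * b)) • T⁻¹))))) Φ :=
  toOp_adelicSiegelLift_of_unipShape F T hT g P hP hN' Φ

include hP hN' hu₀ in
/-- (J-N) conjugated by the frame pair: `ω(u₀ · 𝐫₀ᶜᵒⁿᵗ P · u₀⁻¹) = chirpLM S_b` as well (chirps commute). [cite: Weil1964, Chap. I n° 13 p. 160] -/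
theorem omega_conj_adelicSiegelLiftCont_of_unipShape (Φ : piSchwartzBruhat F (Fin (n + n))) :
    adelicMpCont.omega F (Fin (n + n)) (doubledGramFin F T)
        (u₀ * adelicSiegelLiftCont F (doubledGramFin F T) (isUnit_det_doubledGramFin F T hT) P * u₀⁻¹) Φ =
      chirpLM F (Matrix.reindex finSumFinEquiv finSumFinEquiv
          (Matrix.fromBlocks ((⅟(2 : AdeleRing (𝓞 F) F) * b) • T) 0 0
            (-(((⅟(2 : AdeleRing (𝓞 F) F) * (d * b)) • T⁻¹))))) Φ := by
  refine (omega_mul_mul_apply F T u₀ _ u₀⁻¹ Φ).trans ?_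
  refine (congrArg (adelicMpCont.omega F (Fin (n + n)) (doubledGramFin F T) u₀)
    (omega_adelicSiegelLiftCont_of_unipShape F T hT g P hP hN' _)).trans (Subtype.ext ?_)
  refine (hu₀ _).trans ?_
  refine (congrArg (chirp F (ratMatrix F (frameHalfRat F))) (coe_chirpLM _ _)).trans ?_
  refine (chirp_comm _ _ _).trans ?_
  refine (congrArg (chirp F _) (hu₀ _).symm).trans ?_
  exact (congrArg (fun Ψ : piSchwartzBruhat F (Fin (n + n)) => chirp F _ (Ψ : (Fin (n + n) → AdeleRing (𝓞 F) F) → ℂ))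
    (adelicMpCont.omega_apply_omega_inv_apply F (doubledGramFin F T) u₀ Φ)).trans (coe_chirpLM _ Φ).symm

end Unip

section Torus

variable {p₁ q₁ p₂ q₂ d : AdeleRing (𝓞 F) F}
  (hP : (P : symplecticGroup (polar (adelicForm F (Fin (n + n)) (doubledGramFin F T)))) =
    spReindex finSumFinEquiv (Matrix.fromBlocks T 0 0 (-T)) (doublingDelta T hT * g * (doublingDelta T hT)⁻¹))
  (hD' : ∀ x₁ x₂ y₁ y₂ : Fin n → AdeleRing (𝓞 F) F,
    ((g : symplecticGroup (polar (Matrix.toLinearMap₂' (AdeleRing (𝓞 F) F) (Matrix.fromBlocks T 0 0 (-T))))) :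
        ((Fin n ⊕ Fin n → AdeleRing (𝓞 F) F) × (Fin n ⊕ Fin n → AdeleRing (𝓞 F) F)) ≃ₗ[AdeleRing (𝓞 F) F]
          ((Fin n ⊕ Fin n → AdeleRing (𝓞 F) F) × (Fin n ⊕ Fin n → AdeleRing (𝓞 F) F))).symm (Sum.elim x₁ x₂, Sum.elim y₁ y₂) =
      (Sum.elim ((⅟(2 : AdeleRing (𝓞 F) F)) • ((p₁ • (x₁ + x₂) + (d * q₁) • (y₁ + y₂)) + (p₂ • (x₁ - x₂) + (d * q₂) • (y₁ - y₂))))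
          ((⅟(2 : AdeleRing (𝓞 F) F)) • ((p₁ • (x₁ + x₂) + (d * q₁) • (y₁ + y₂)) - (p₂ • (x₁ - x₂) + (d * q₂) • (y₁ - y₂)))),
        Sum.elim ((⅟(2 : AdeleRing (𝓞 F) F)) • ((q₁ • (x₁ + x₂) + p₁ • (y₁ + y₂)) + (q₂ • (x₁ - x₂) + p₂ • (y₁ - y₂))))
          ((⅟(2 : AdeleRing (𝓞 F) F)) • ((q₁ • (x₁ + x₂) + p₁ • (y₁ + y₂)) - (q₂ • (x₁ - x₂) + p₂ • (y₁ - y₂))))))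
  (hTs : T.IsSymm) (hUV₁ : p₁ * p₂ - d * q₁ * q₂ = 1) (hUV₂ : p₁ * q₂ = q₁ * p₂)
  (M : GL (Fin (n + n)) (AdeleRing (𝓞 F) F))
  (hM : (M : Matrix (Fin (n + n)) (Fin (n + n)) (AdeleRing (𝓞 F) F)) =
    Matrix.reindex finSumFinEquiv finSumFinEquiv
      (Matrix.fromBlocks (p₂ • (1 : Matrix (Fin n) (Fin n) (AdeleRing (𝓞 F) F))) (q₂ • T) ((d * q₂) • T⁻¹)
        (p₂ • (1 : Matrix (Fin n) (Fin n) (AdeleRing (𝓞 F) F)))))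

include hP hD' hTs hUV₁ hUV₂ hM hu₀ in
/-- **(J-D) THE TORUS TRANSLATE IN THE GROUP OF RECORD IS A PURE TWIST**: `ω(u₀ · 𝐫₀ᶜᵒⁿᵗ P · u₀⁻¹) = twistLM M` for `P = δ d δ⁻¹`,
`u₀` the frame pair, `M = M_Vᵀ♮` (Weil's `d₀(α)`; no chirp, no phase). [cite: Weil1964, Chap. I n° 13 p. 160] [cite: Weil1965, n° 46 p. 66] -/
theorem omega_conj_adelicSiegelLiftCont_of_torusShape (Φ : piSchwartzBruhat F (Fin (n + n))) :
    adelicMpCont.omega F (Fin (n + n)) (doubledGramFin F T)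
        (u₀ * adelicSiegelLiftCont F (doubledGramFin F T) (isUnit_det_doubledGramFin F T hT) P * u₀⁻¹) Φ =
      twistLM F M Φ := by
  refine (omega_mul_mul_apply F T u₀ _ u₀⁻¹ Φ).trans (Subtype.ext ?_)
  refine (hu₀ _).trans ?_
  refine (chirp_frameHalf_toOp_adelicSiegelLift_eq_twist_of_torusShape F T hT g P hP hD' hTs hUV₁ hUV₂ M hM _).trans ?_
  refine (congrArg (twist F M) (hu₀ _).symm).trans ?_
  exact (congrArg (fun Ψ : piSchwartzBruhat F (Fin (n + n)) => twist F M (Ψ : (Fin (n + n) → AdeleRing (𝓞 F) F) → ℂ))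
    (adelicMpCont.omega_apply_omega_inv_apply F (doubledGramFin F T) u₀ Φ)).trans (coe_twistLM M Φ).symm

include hP hD' hTs hUV₁ hUV₂ hM hu₀ in
/-- **(J-ND) A UNIPOTENT·TORUS TRANSLATE IN THE GROUP OF RECORD**: for `P_N = δ n δ⁻¹` (unipotent shape `b`) and `P = δ d δ⁻¹` (torus shape),
`ω(u₀ · 𝐫₀ᶜᵒⁿᵗ(P_N · P) · u₀⁻¹) Ψ = chirpLM S_b (twistLM M Ψ)` — EXACTLY the hypothesis shape `hGω` of ★ `exists_borelBound`
(`S := S_h`, `βc q := ½ b`-scaled, `ac q · z(ρ)⁻¹ := M`). [cite: Weil1964, Chap. I n° 13 p. 160] [cite: Weil1965, n° 46 p. 66] -/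
theorem omega_conj_adelicSiegelLiftCont_mul {b : AdeleRing (𝓞 F) F}
    (hPN : (PN : symplecticGroup (polar (adelicForm F (Fin (n + n)) (doubledGramFin F T)))) =
      spReindex finSumFinEquiv (Matrix.fromBlocks T 0 0 (-T)) (doublingDelta T hT * gN * (doublingDelta T hT)⁻¹))
    (hN' : ∀ x₁ x₂ y₁ y₂ : Fin n → AdeleRing (𝓞 F) F,
      ((gN : symplecticGroup (polar (Matrix.toLinearMap₂' (AdeleRing (𝓞 F) F) (Matrix.fromBlocks T 0 0 (-T))))) :
          ((Fin n ⊕ Fin n → AdeleRing (𝓞 F) F) × (Fin n ⊕ Fin n → AdeleRing (𝓞 F) F)) ≃ₗ[AdeleRing (𝓞 F) F]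
            ((Fin n ⊕ Fin n → AdeleRing (𝓞 F) F) × (Fin n ⊕ Fin n → AdeleRing (𝓞 F) F))).symm (Sum.elim x₁ x₂, Sum.elim y₁ y₂) =
        (Sum.elim (x₁ + (d * b) • (y₁ - y₂)) (x₂ + (d * b) • (y₁ - y₂)),
          Sum.elim (y₁ + b • (x₁ - x₂)) (y₂ + b • (x₁ - x₂))))
    (Ψ : piSchwartzBruhat F (Fin (n + n))) :
    adelicMpCont.omega F (Fin (n + n)) (doubledGramFin F T)
        (u₀ * adelicSiegelLiftCont F (doubledGramFin F T) (isUnit_det_doubledGramFin F T hT) (PN * P) * u₀⁻¹) Ψ =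
      chirpLM F (Matrix.reindex finSumFinEquiv finSumFinEquiv
          (Matrix.fromBlocks ((⅟(2 : AdeleRing (𝓞 F) F) * b) • T) 0 0
            (-(((⅟(2 : AdeleRing (𝓞 F) F) * (d * b)) • T⁻¹)))))
        (twistLM F M Ψ) := by
  have hm : adelicSiegelLiftCont F (doubledGramFin F T) (isUnit_det_doubledGramFin F T hT) (PN * P) =
      adelicSiegelLiftCont F (doubledGramFin F T) (isUnit_det_doubledGramFin F T hT) PN *
        adelicSiegelLiftCont F (doubledGramFin F T) (isUnit_det_doubledGramFin F T hT) P := map_mul _ _ _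
  have hsplit : u₀ * adelicSiegelLiftCont F (doubledGramFin F T) (isUnit_det_doubledGramFin F T hT) (PN * P) * u₀⁻¹ =
      (u₀ * adelicSiegelLiftCont F (doubledGramFin F T) (isUnit_det_doubledGramFin F T hT) PN * u₀⁻¹) *
        (u₀ * adelicSiegelLiftCont F (doubledGramFin F T) (isUnit_det_doubledGramFin F T hT) P * u₀⁻¹) := by
    simp only [hm, mul_assoc, inv_mul_cancel_left]
  refine (congrArg (fun z => adelicMpCont.omega F (Fin (n + n)) (doubledGramFin F T) z Ψ) hsplit).trans ?_
  refine (adelicMpCont.omega_mul_apply F (doubledGramFin F T)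
    (u₀ * adelicSiegelLiftCont F (doubledGramFin F T) (isUnit_det_doubledGramFin F T hT) PN * u₀⁻¹)
    (u₀ * adelicSiegelLiftCont F (doubledGramFin F T) (isUnit_det_doubledGramFin F T hT) P * u₀⁻¹) Ψ).trans ?_
  refine (congrArg (adelicMpCont.omega F (Fin (n + n)) (doubledGramFin F T) _)
    (omega_conj_adelicSiegelLiftCont_of_torusShape F T hT g P u₀ hu₀ hP hD' hTs hUV₁ hUV₂ M hM Ψ)).trans ?_
  exact omega_conj_adelicSiegelLiftCont_of_unipShape F T hT gN PN u₀ hu₀ hPN hN' _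

end Torus

section RealRay

variable {p₁ p₂ : AdeleRing (𝓞 F) F}
  (hP : (P : symplecticGroup (polar (adelicForm F (Fin (n + n)) (doubledGramFin F T)))) =
    spReindex finSumFinEquiv (Matrix.fromBlocks T 0 0 (-T)) (doublingDelta T hT * g * (doublingDelta T hT)⁻¹))
  (hR' : ∀ x₁ x₂ y₁ y₂ : Fin n → AdeleRing (𝓞 F) F,
    ((g : symplecticGroup (polar (Matrix.toLinearMap₂' (AdeleRing (𝓞 F) F) (Matrix.fromBlocks T 0 0 (-T))))) :
        ((Fin n ⊕ Fin n → AdeleRing (𝓞 F) F) × (Fin n ⊕ Fin n → AdeleRing (𝓞 F) F)) ≃ₗ[AdeleRing (𝓞 F) F]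
          ((Fin n ⊕ Fin n → AdeleRing (𝓞 F) F) × (Fin n ⊕ Fin n → AdeleRing (𝓞 F) F))).symm (Sum.elim x₁ x₂, Sum.elim y₁ y₂) =
      (Sum.elim ((⅟(2 : AdeleRing (𝓞 F) F)) • (p₁ • (x₁ + x₂) + p₂ • (x₁ - x₂)))
          ((⅟(2 : AdeleRing (𝓞 F) F)) • (p₁ • (x₁ + x₂) - p₂ • (x₁ - x₂))),
        Sum.elim ((⅟(2 : AdeleRing (𝓞 F) F)) • (p₁ • (y₁ + y₂) + p₂ • (y₁ - y₂)))
          ((⅟(2 : AdeleRing (𝓞 F) F)) • (p₁ • (y₁ + y₂) - p₂ • (y₁ - y₂)))))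
  (hTs : T.IsSymm) (hp : p₁ * p₂ = 1)
  (M : GL (Fin (n + n)) (AdeleRing (𝓞 F) F))
  (hM : (M : Matrix (Fin (n + n)) (Fin (n + n)) (AdeleRing (𝓞 F) F)) = p₂ • (1 : Matrix (Fin (n + n)) (Fin (n + n)) (AdeleRing (𝓞 F) F)))

include hP hR' hTs hp hM hu₀ in
/-- **(J-D) ON THE REAL RAY**: `ω(u₀ · 𝐫₀ᶜᵒⁿᵗ P · u₀⁻¹) = twistLM (p₂ • 1)` for the real-scalar torus translate (`g⁻¹` = `p₁` on `W^Δ`,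
`p₂` on `W^∇`, `p₁ p₂ = 1`) — the dilation of the boundedness step (`M = a · z(ρ)⁻¹` with `a = 1` in ★ `exists_borelBound`).
[cite: Weil1964, Chap. I n° 13 p. 160] [cite: Weil1965, n° 47 Lemma 20 and n° 50] -/
theorem omega_conj_adelicSiegelLiftCont_of_realRay (Φ : piSchwartzBruhat F (Fin (n + n))) :
    adelicMpCont.omega F (Fin (n + n)) (doubledGramFin F T)
        (u₀ * adelicSiegelLiftCont F (doubledGramFin F T) (isUnit_det_doubledGramFin F T hT) P * u₀⁻¹) Φ =
      twistLM F M Φ := by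
  refine (omega_mul_mul_apply F T u₀ _ u₀⁻¹ Φ).trans (Subtype.ext ?_)
  refine (hu₀ _).trans (funext fun x => ?_)
  refine (chirp_frameHalf_toOp_adelicSiegelLift_of_realRay F T hT g P hP hR' hTs hp _ x).trans ?_
  have hx : p₂ • x = x ᵥ* (M : Matrix (Fin (n + n)) (Fin (n + n)) (AdeleRing (𝓞 F) F)) := by
    rw [hM, Matrix.vecMul_smul, Matrix.vecMul_one]
  refine (congrFun ((hu₀ _).symm.trans (congrArg
    (fun Ψ : piSchwartzBruhat F (Fin (n + n)) => ((Ψ : piSchwartzBruhat F (Fin (n + n))) : (Fin (n + n) → AdeleRing (𝓞 F) F) → ℂ))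
    (adelicMpCont.omega_apply_omega_inv_apply F (doubledGramFin F T) u₀ Φ))) (p₂ • x)).trans ?_
  rw [coe_twistLM, twist_apply, hx]

end RealRay

end Junction

/-! ## §3 (J-R) Conjugates of Weil's rational section: the isometric elements of the boundedness step -/

section Rational

omit [MeasurableSpace (AdeleRing (𝓞 F) F)] [BorelSpace (AdeleRing (𝓞 F) F)]

/-- **(J-R) π of a conjugated rational lift**: `π(u · r_F(γ) · u⁻¹) = π(u) · ratSp γ · π(u)⁻¹` — with `u = ũ = u₀ · r_F(δ̃)` and
`γ = γ̃` rational this is the frame conjugate `δ♮ ι(γ) δ♮⁻¹` of a rational point of the small group. [cite: Weil1964, Chap. III n° 40 p. 190] -/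
theorem proj_conj_ratThetaLiftCont (u : adelicMpCont F (Fin (n + n)) (doubledGramFin F T))
    (γ : Matrix.symplecticGroup (Fin (n + n)) F) :
    adelicMpCont.proj F (Fin (n + n)) (doubledGramFin F T)
        (u * ratThetaLiftCont F (doubledGramFin F T) (isUnit_det_doubledGramFin F T hT) γ * u⁻¹) =
      adelicMpCont.proj F (Fin (n + n)) (doubledGramFin F T) u *
        ratSp F (doubledGramFin F T) (isUnit_det_doubledGramFin F T hT) γ *
          (adelicMpCont.proj F (Fin (n + n)) (doubledGramFin F T) u)⁻¹ :=
  (map_mul (adelicMpCont.proj F (Fin (n + n)) (doubledGramFin F T)) _ _).trans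
    (congrArg₂ (· * ·) ((map_mul (adelicMpCont.proj F (Fin (n + n)) (doubledGramFin F T)) _ _).trans
      (congrArg (adelicMpCont.proj F (Fin (n + n)) (doubledGramFin F T) u * ·)
        (proj_ratThetaLiftCont F (doubledGramFin F T) (isUnit_det_doubledGramFin F T hT) γ)))
      (map_inv (adelicMpCont.proj F (Fin (n + n)) (doubledGramFin F T)) u))

end Rational

/-- **(J-R) conjugated rational lifts are `L²`-isometric**: `L(u · r_F(γ) · u⁻¹) = 1` (`L(r_F γ) = 1`, ★ `l2Scaling_ratThetaLiftCont`;
`L` is multiplicative) — the `hR`∕`hINV` modulus clause of ★ `exists_borelBound`. [cite: Weil1964, Chap. III n° 40 p. 190] -/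
theorem l2Scaling_conj_ratThetaLiftCont (u : adelicMpCont F (Fin (n + n)) (doubledGramFin F T))
    (γ : Matrix.symplecticGroup (Fin (n + n)) F) :
    adelicMpCont.l2Scaling F (doubledGramFin F T) (isUnit_det_doubledGramFin F T hT) ν
        (u * ratThetaLiftCont F (doubledGramFin F T) (isUnit_det_doubledGramFin F T hT) γ * u⁻¹) = 1 := by
  rw [adelicMpCont.l2Scaling_mul, adelicMpCont.l2Scaling_mul, adelicMpCont.l2Scaling_ratThetaLiftCont, mul_one,
    adelicMpCont.l2Scaling_inv, ENNReal.mul_inv_cancel (adelicMpCont.l2Scaling_ne_zero F _ _ ν u)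
      (adelicMpCont.l2Scaling_ne_top F _ _ ν u)]


end Literature.NumberTheory.Weil1964
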